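import Literature.AlgebraicGeometry.HodgeTheory.SpecialisedHypersurfaceFamilyFunctorial
import Literature.AlgebraicGeometry.HodgeTheory.CyclicCoverBaseChart
import Literature.AlgebraicGeometry.HodgeTheory.CyclicCoverScalingFamily
import HarnessLib

/-!
# Linear pencils `x₃^p = f₀ + u·g` of cyclic covers of the plane as sub-families of the Carlson–Toledo family

Family `hodge`, layer `Literature/AlgebraicGeometry/HodgeTheory`, namespace `…HodgeTheory.LinearPencil`
(the names `pencilCoord`, `continuous_pencilCoord` are taken by the NODAL pencil files `CyclicCoverPencil*`);
small definitions (`pencilSpz`, `pencilCoord`, `pencilChart`, three abbreviations) and proved bookkeeping, no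
named fact. Written by
the prover seat `hodge-nonav-prover-Ax` (g14) for route `CyclicUnitaryPowers` (crux K1, stmt-HodgeConjecture-19544),
programme ZARISKI: the one-parameter ALGEBRAIC sub-families of the Carlson–Toledo family
`u : 𝒴 ⟶ S = cyclicCoverBase p` (`CyclicCoverUniversalFamily`) given by a PENCIL of branch forms
`f_u = f₀ + u g` (`f₀, g` coefficient vectors of ternary `p`-forms), as needed by the curve theorem
`CyclicUnitaryPowersCurvesOfLargeMonodromyHodgeOffCountable` (a morphism `ι : P ⟶ S` from a smooth curve).

* §1 `pencilSpz f₀ g : ℂ[b_e] →ₐ ℂ[c]`, `b_e ↦ (f₀)_e + g_e c` (surjective for `g ≠ 0`); the base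
  `pencilBase p f₀ g = baseSpz (pencilSpz ∘ φ_p)` — the open set of `u ∈ 𝔸¹` with `x₃^p − f_u` nonsingular —
  and the morphism `pencilMap p f₀ g : pencilBase ⟶ cyclicCoverBase p` (`baseSpzMap`, file
  `SpecialisedHypersurfaceFamilyFunctorial`).
* §2 The coordinate `pencilCoord c = ψ_c(c) ∈ ℂ` of a point `c` of the pencil base, and **the branch form of
  its image: `coeff_e f_{ι c} = (f₀)_e + pencilCoord c · g_e`** (`coeff_branchForm_map_pencilMap`).
* §3 The coordinate is a topological embedding `P(ℂ) ↪ ℂ` (through the closed immersion `S_{φ'} ↪ U` and the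
  coefficient chart of `U(ℂ)`, `isEmbedding_map_toBaseSpz`, `isEmbedding_coeffVector`) with image the set of
  `u` with `x₃^p − f_u` nonsingular (`range_pencilCoord`); the chart `pencilChart : P(ℂ) ≃ₜ {u | x₃^p − f_u nonsingular}`.

## References

* [CarlsonToledo1999] J. A. Carlson, D. Toledo, Discriminant complements and kernels of monodromy
  representations, Duke Math. J. 97 (1999), §2 (the universal family `Ũ` of cyclic covers; held text p0004).
* [VoisinHodgeII2003] C. Voisin, *Hodge Theory and Complex Algebraic Geometry II*, CUP 2003, §6.2.1, §2.1–2.3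
  (pencils in the space of forms).
* [SerreGAGA1956] J.-P. Serre, GAGA, §2 n°5 (strong topology of points).
-/

noncomputable section

namespace Literature.AlgebraicGeometry.HodgeTheory

open CategoryTheory MvPolynomial _root_.Topology
open Literature.AlgebraicGeometry.Motives Literature.AlgebraicGeometry.Motives.UniversalHypersurface
open Literature.AlgebraicGeometry.Motives.SmoothHypersurface (IsNonsingularForm)
open Literature.AlgebraicGeometry.HodgeTheory.UniversalHypersurface

namespace LinearPencil

/-! ### §1 The pencil specialisation and the pencil base -/

section Pencil

variable (p : ℕ) (f₀ g : TernaryIndex p → ℂ)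

/-- **The pencil specialisation** `b_e ↦ (f₀)_e + g_e · c` of the ternary coefficients along the line through
`f₀` in the direction `g` (`c = X 0` the pencil parameter). [cite: VoisinHodgeII2003, §2.1 (pencils of hypersurfaces)] -/
def pencilSpz : MvPolynomial (TernaryIndex p) ℂ →ₐ[ℂ] MvPolynomial (Fin 1) ℂ :=
  MvPolynomial.aeval fun e => C (f₀ e) + C (g e) * X 0

/-- `pencilSpz` on a coordinate. [cite: VoisinHodgeII2003, §2.1] -/
@[simp] theorem pencilSpz_X (e : TernaryIndex p) :
    pencilSpz p f₀ g (X e) = C (f₀ e) + C (g e) * X 0 := MvPolynomial.aeval_X _ _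

/-- Evaluation: `(pencilSpz q)(u) = q(f₀ + u g)`. [cite: VoisinHodgeII2003, §2.1] -/
theorem eval_pencilSpz (q : MvPolynomial (TernaryIndex p) ℂ) (u : ℂ) :
    MvPolynomial.eval (fun _ : Fin 1 => u) (pencilSpz p f₀ g q) = MvPolynomial.eval (fun e => f₀ e + u * g e) q := by
  induction q using MvPolynomial.induction_on with
  | C a => simp [pencilSpz]
  | add p q hp hq => simp only [map_add, hp, hq]
  | mul_X q e hq => simp only [map_mul, hq, pencilSpz_X, map_add, MvPolynomial.eval_C, MvPolynomial.eval_X]; ring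

variable {g} in
/-- For `g ≠ 0` the pencil specialisation is surjective (`c = (b_e − (f₀)_e)/g_e` for `g_e ≠ 0`).
[cite: VoisinHodgeII2003, §2.1] -/
theorem pencilSpz_surjective (hg : g ≠ 0) : Function.Surjective (pencilSpz p f₀ g) := by
  obtain ⟨e, he⟩ : ∃ e, g e ≠ 0 := by
    by_contra h; push Not at h; exact hg (funext h)
  intro q
  refine ⟨MvPolynomial.aeval (fun _ : Fin 1 => C (g e)⁻¹ * (X e - C (f₀ e))) q, ?_⟩
  rw [← AlgHom.comp_apply]
  have hcomp : (pencilSpz p f₀ g).comp (MvPolynomial.aeval fun _ : Fin 1 => C (g e)⁻¹ * (X e - C (f₀ e))) =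
      AlgHom.id ℂ _ := by
    refine MvPolynomial.algHom_ext fun i => ?_
    fin_cases i
    rw [AlgHom.comp_apply, MvPolynomial.aeval_X, map_mul, map_sub, pencilSpz_X, AlgHom.id_apply,
      MvPolynomial.algHom_C, MvPolynomial.algHom_C]
    change C (g e)⁻¹ * (C (f₀ e) + C (g e) * X 0 - C (f₀ e)) = (X 0 : MvPolynomial (Fin 1) ℂ)
    rw [add_sub_cancel_left, ← mul_assoc, ← map_mul, inv_mul_cancel₀ he, map_one, one_mul]
  rw [hcomp, AlgHom.id_apply]

/-- The composite specialisation `φ' = pencilSpz ∘ φ_p : ℂ[a_m] → ℂ[c]` of the pencil `x₃^p − (f₀ + c g)`.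
[cite: CarlsonToledo1999, §2 (held text p0004)] -/
abbrev pencilCompSpz : CoeffRing ℂ 2 p →ₐ[ℂ] MvPolynomial (Fin 1) ℂ := (pencilSpz p f₀ g).comp (cyclicCoverSpz p)

/-- **The base of the pencil**: the open subscheme of `𝔸¹ = Spec ℂ[c]` of parameters `u` with `x₃^p − (f₀ + u g)`
nonsingular. [cite: VoisinHodgeII2003, §6.2.1] -/
abbrev pencilBase : SchemeOver ℂ := baseSpz ℂ 2 p (pencilCompSpz p f₀ g)

/-- **The pencil as a morphism into the Carlson–Toledo base** `ι : pencilBase ⟶ cyclicCoverBase p`.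
[cite: CarlsonToledo1999, §2 (held text p0004)] -/
abbrev pencilMap : pencilBase p f₀ g ⟶ cyclicCoverBase p := baseSpzMap ℂ 2 p (cyclicCoverSpz p) (pencilSpz p f₀ g)

variable {g} in
/-- The composite specialisation is surjective for `g ≠ 0` (`p ≠ 0`). [cite: CarlsonToledo1999, §2 (held text p0004)] -/
theorem pencilCompSpz_surjective (hp : p ≠ 0) (hg : g ≠ 0) : Function.Surjective (pencilCompSpz p f₀ g) :=
  (pencilSpz_surjective p f₀ hg).comp (cyclicCoverSpz_surjective p hp)

end Pencil

/-! ### §2 The coordinate of a point of the pencil base and the branch form of its image -/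

section Coordinate

variable (p : ℕ) (f₀ g : TernaryIndex p → ℂ)

/-- **The coordinate `u = ψ_c(c) ∈ ℂ`** of a complex point `c` of the pencil base.
[cite: VoisinHodgeII2003, §6.2.1] -/
def pencilCoord (c : ComplexPoints (pencilBase p f₀ g)) : ℂ :=
  pointAlgHomSpz ℂ 2 p (pencilCompSpz p f₀ g) c (X 0)

/-- The coefficient homomorphism of a point of the pencil base is evaluation at its coordinate.
[cite: VoisinHodgeII2003, §6.2.1] -/
theorem pointAlgHomSpz_eq_aeval (c : ComplexPoints (pencilBase p f₀ g)) :
    pointAlgHomSpz ℂ 2 p (pencilCompSpz p f₀ g) c = MvPolynomial.aeval fun _ : Fin 1 => pencilCoord p f₀ g c := by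
  refine MvPolynomial.algHom_ext fun i => ?_
  fin_cases i
  rw [MvPolynomial.aeval_X]
  rfl

/-- Values of the coefficient homomorphism: `ψ_c(q) = q(pencilCoord c)`. [cite: VoisinHodgeII2003, §6.2.1] -/
theorem pointAlgHomSpz_apply_eq_eval (c : ComplexPoints (pencilBase p f₀ g)) (q : MvPolynomial (Fin 1) ℂ) :
    pointAlgHomSpz ℂ 2 p (pencilCompSpz p f₀ g) c q = MvPolynomial.eval (fun _ : Fin 1 => pencilCoord p f₀ g c) q := by
  rw [pointAlgHomSpz_eq_aeval]
  exact congrFun (MvPolynomial.aeval_eq_eval (f := fun _ : Fin 1 => pencilCoord p f₀ g c)) q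

/-- **The branch form of the image point**: `coeff_e f_{ι c} = (f₀)_e + pencilCoord c · g_e`.
[cite: CarlsonToledo1999, §2 (held text p0004)] -/
theorem coeff_branchForm_map_pencilMap (c : ComplexPoints (pencilBase p f₀ g)) (e : TernaryIndex p) :
    (branchForm p (AlgPoints.map (pencilMap p f₀ g) c)).coeff e.1 = f₀ e + pencilCoord p f₀ g c * g e := by
  rw [coeff_branchForm, pointAlgHomSpz_map_baseSpzMap, pointAlgHomSpz_apply_eq_eval, eval_pencilSpz, MvPolynomial.eval_X]

/-- The branch form of the image point is `Σ_e ((f₀)_e + u g_e) x^e`, `u = pencilCoord c`.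
[cite: CarlsonToledo1999, §2 (held text p0004)] -/
theorem branchForm_map_pencilMap (c : ComplexPoints (pencilBase p f₀ g)) :
    branchForm p (AlgPoints.map (pencilMap p f₀ g) c) =
      ∑ e : TernaryIndex p, monomial e.1 (f₀ e + pencilCoord p f₀ g c * g e) := by
  rw [← sum_monomial_coeff_branchForm]
  exact Finset.sum_congr rfl fun e _ => by rw [coeff_branchForm_map_pencilMap]

/-- **Points of the pencil base have nonsingular forms**: `x₃^p − f_u` is nonsingular for `u = pencilCoord c`.
[cite: CarlsonToledo1999, §2 (held text p0004)] -/
theorem isNonsingularForm_pencilCoord [NeZero p] (c : ComplexPoints (pencilBase p f₀ g)) :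
    IsNonsingularForm ℂ (cyclicCoverForm p (∑ e : TernaryIndex p, monomial e.1 (f₀ e + pencilCoord p f₀ g c * g e))) := by
  have h := (Set.ext_iff.1 (range_coeffChart p) (fun e => f₀ e + pencilCoord p f₀ g c * g e)).1
    ⟨AlgPoints.map (pencilMap p f₀ g) c, funext fun e => coeff_branchForm_map_pencilMap p f₀ g c e⟩
  exact h

/-- The coordinate is injective (a point of `S_{φ'} ⊆ 𝔸¹` is determined by its coefficient homomorphism).
[cite: VoisinHodgeII2003, §6.2.1] -/
theorem pencilCoord_injective : Function.Injective (pencilCoord p f₀ g) := by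
  intro c c' h
  apply pointHomSpz_injective ℂ 2 p (pencilCompSpz p f₀ g)
  have h1 := pointAlgHomSpz_eq_aeval p f₀ g c
  have h2 := pointAlgHomSpz_eq_aeval p f₀ g c'
  rw [h] at h1
  have h3 : pointAlgHomSpz ℂ 2 p (pencilCompSpz p f₀ g) c = pointAlgHomSpz ℂ 2 p (pencilCompSpz p f₀ g) c' :=
    h1.trans h2.symm
  ext1
  refine RingHom.ext fun q => ?_
  have := congrArg (fun χ : MvPolynomial (Fin 1) ℂ →ₐ[ℂ] ℂ => χ q) h3
  simpa only [pointAlgHomSpz_apply] using this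

/-- The coefficient homomorphism `c ↦ u` of the parameter `u ∈ ℂ`. [cite: VoisinHodgeII2003, §6.2.1] -/
private theorem aeval_comp_pencilCompSpz (hp : p ≠ 0) (u : ℂ) :
    (MvPolynomial.aeval fun _ : Fin 1 => u).comp (pencilCompSpz p f₀ g) =
      coeffHom ℂ 2 p (cyclicCoverForm p (∑ e : TernaryIndex p, monomial e.1 (f₀ e + u * g e))) := by
  rw [pencilCompSpz, ← AlgHom.comp_assoc, ← ternaryCoeffHom_comp_cyclicCoverSpz p hp]
  congr 1
  refine MvPolynomial.algHom_ext fun e => ?_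
  rw [AlgHom.comp_apply, pencilSpz_X, ternaryCoeffHom_X, coeff_sum_monomial]
  simp [mul_comm]

/-- **Every parameter `u` with `x₃^p − f_u` nonsingular is the coordinate of a point of the pencil base.**
[cite: VoisinHodgeII2003, §6.2.1] -/
theorem exists_pencilCoord_eq [NeZero p] {u : ℂ}
    (hu : IsNonsingularForm ℂ (cyclicCoverForm p (∑ e : TernaryIndex p, monomial e.1 (f₀ e + u * g e)))) :
    ∃ c : ComplexPoints (pencilBase p f₀ g), pencilCoord p f₀ g c = u := by
  have hG := CyclicCoverFormNonsingular.isHomogeneous_cyclicCoverForm_of_isHomogeneous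
    (isHomogeneous_sum_monomial p (fun e => f₀ e + u * g e))
  refine ⟨pointOfFormSpz ℂ 2 p (pencilCompSpz p f₀ g) hG hu (aeval_comp_pencilCompSpz p f₀ g (NeZero.ne p) u), ?_⟩
  rw [pencilCoord, pointAlgHomSpz_apply, pointHomSpz_pointOfFormSpz, CommRingCat.hom_ofHom]
  change (MvPolynomial.aeval fun _ : Fin 1 => u) (X 0 : MvPolynomial (Fin 1) ℂ) = u
  rw [MvPolynomial.aeval_X]

/-- **The image of the coordinate**: exactly the parameters `u` with `x₃^p − (f₀ + u g)` nonsingular.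
[cite: CarlsonToledo1999, §2 (held text p0004: `Ũ = ℂ^{N+1} − Δ̃`)] -/
theorem range_pencilCoord [NeZero p] :
    Set.range (pencilCoord p f₀ g) =
      {u | IsNonsingularForm ℂ (cyclicCoverForm p (∑ e : TernaryIndex p, monomial e.1 (f₀ e + u * g e)))} := by
  ext u
  constructor
  · rintro ⟨c, rfl⟩
    exact isNonsingularForm_pencilCoord p f₀ g c
  · intro hu
    exact exists_pencilCoord_eq p f₀ g hu

end Coordinate

/-! ### §3 The coordinate is a topological embedding; the inverse chart -/

section Chart

variable (p : ℕ) (f₀ g : TernaryIndex p → ℂ)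

/-- The coefficient vector of the quaternary form of a point of the pencil is a polynomial function of the
coordinate: `coeffVector [x₃^p − f_{u}] m = (φ'(a_m))(u)`. [cite: VoisinHodgeII2003, §6.2.1] -/
theorem coeffVector_map_toBaseSpz_pencil (c : ComplexPoints (pencilBase p f₀ g)) (m : DegIndex 2 p) :
    coeffVector ℂ 2 p (AlgPoints.map (toBaseSpz ℂ 2 p (pencilCompSpz p f₀ g)) c) m =
      MvPolynomial.eval (fun _ : Fin 1 => pencilCoord p f₀ g c) (pencilCompSpz p f₀ g (X m)) := by
  rw [coeffVector_apply]
  change coeff m.1 (pointFormSpz ℂ 2 p (pencilCompSpz p f₀ g) c) = _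
  rw [coeff_pointFormSpz, ← pointAlgHomSpz_apply, pointAlgHomSpz_apply_eq_eval]

variable {g}

/-- The coefficient `a_{(e,0)}` of the quaternary form of a point of the pencil: `−((f₀)_e + u g_e)`.
[cite: CarlsonToledo1999, §2 (held text p0004)] -/
theorem coeffVector_map_toBaseSpz_pencil_extendIndex [NeZero p] (c : ComplexPoints (pencilBase p f₀ g))
    (e : TernaryIndex p) :
    coeffVector ℂ 2 p (AlgPoints.map (toBaseSpz ℂ 2 p (pencilCompSpz p f₀ g)) c) (extendIndex e) =
      -(f₀ e + pencilCoord p f₀ g c * g e) := by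
  rw [coeffVector_map_toBaseSpz_pencil, pencilCompSpz, AlgHom.comp_apply, cyclicCoverSpz_X_extendIndex p (NeZero.ne p),
    map_neg, map_neg, eval_pencilSpz, MvPolynomial.eval_X]

/-- **The coordinate is continuous** (`g ≠ 0`): it is an affine function of a coefficient of the quaternary form,
which is continuous on `U(ℂ)` (`continuous_coeffVector`). [cite: SerreGAGA1956, §2 n°5] -/
theorem continuous_pencilCoord [NeZero p] (hg : g ≠ 0) : Continuous (pencilCoord p f₀ g) := by
  obtain ⟨e, he⟩ : ∃ e, g e ≠ 0 := by
    by_contra h; push Not at h; exact hg (funext h)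
  have hcont : Continuous fun c : ComplexPoints (pencilBase p f₀ g) =>
      coeffVector ℂ 2 p (AlgPoints.map (toBaseSpz ℂ 2 p (pencilCompSpz p f₀ g)) c) (extendIndex e) :=
    (continuous_apply (extendIndex e)).comp ((continuous_coeffVector ℂ 2 p).comp (AlgPoints.continuous_map _))
  have heq : (pencilCoord p f₀ g) = fun c =>
      (-(coeffVector ℂ 2 p (AlgPoints.map (toBaseSpz ℂ 2 p (pencilCompSpz p f₀ g)) c) (extendIndex e)) - f₀ e) / g e := by
    funext c
    rw [coeffVector_map_toBaseSpz_pencil_extendIndex, neg_neg, add_sub_cancel_left, mul_div_cancel_right₀ _ he]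
  rw [heq]
  exact ((hcont.neg.sub continuous_const).div_const _)

/-- **The coordinate is a topological embedding `P(ℂ) ↪ ℂ`** (`g ≠ 0`): the coefficient vector of the image in
`U(ℂ)`, an embedding (`isEmbedding_map_toBaseSpz`, `isEmbedding_coeffVector`), is a continuous function of the
coordinate. [cite: SerreGAGA1956, §2 n°5] -/
theorem isEmbedding_pencilCoord [NeZero p] (hg : g ≠ 0) : IsEmbedding (pencilCoord p f₀ g) := by
  let A : ℂ → (DegIndex 2 p → ℂ) := fun u m => MvPolynomial.eval (fun _ : Fin 1 => u) (pencilCompSpz p f₀ g (X m))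
  have hA : Continuous A :=
    continuous_pi fun m => (MvPolynomial.continuous_eval _).comp (continuous_pi fun _ => continuous_id)
  have hE : IsEmbedding fun c : ComplexPoints (pencilBase p f₀ g) =>
      coeffVector ℂ 2 p (AlgPoints.map (toBaseSpz ℂ 2 p (pencilCompSpz p f₀ g)) c) :=
    (isEmbedding_coeffVector ℂ 2 p).comp
      (CyclicCoverScaling.isEmbedding_map_toBaseSpz (pencilCompSpz p f₀ g) (pencilCompSpz_surjective p f₀ (NeZero.ne p) hg))
  have hcomp : (fun c : ComplexPoints (pencilBase p f₀ g) =>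
      coeffVector ℂ 2 p (AlgPoints.map (toBaseSpz ℂ 2 p (pencilCompSpz p f₀ g)) c)) = A ∘ pencilCoord p f₀ g := by
    funext c; funext m
    exact coeffVector_map_toBaseSpz_pencil p f₀ g c m
  rw [hcomp] at hE
  exact ⟨IsInducing.of_comp (continuous_pencilCoord p f₀ hg) hA hE.isInducing, pencilCoord_injective p f₀ g⟩

/-- **The chart of the pencil base**: `P(ℂ) ≃ₜ {u | x₃^p − (f₀ + u g) nonsingular} ⊆ ℂ`, reading the coordinate
(`g ≠ 0`). [cite: SerreGAGA1956, §2 n°5] [cite: CarlsonToledo1999, §2 (held text p0004)] -/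
def pencilChart [NeZero p] (hg : g ≠ 0) :
    ComplexPoints (pencilBase p f₀ g) ≃ₜ
      {u : ℂ | IsNonsingularForm ℂ (cyclicCoverForm p (∑ e : TernaryIndex p, monomial e.1 (f₀ e + u * g e)))} :=
  (isEmbedding_pencilCoord p f₀ hg).toHomeomorph.trans (Homeomorph.setCongr (range_pencilCoord p f₀ g))

/-- The chart reads the coordinate. [cite: SerreGAGA1956, §2 n°5] -/
@[simp] theorem pencilChart_apply_coe [NeZero p] (hg : g ≠ 0) (c : ComplexPoints (pencilBase p f₀ g)) :
    ((pencilChart p f₀ hg c : _) : ℂ) = pencilCoord p f₀ g c := rfl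

/-- The inverse chart produces the point with the given coordinate. [cite: SerreGAGA1956, §2 n°5] -/
@[simp] theorem pencilCoord_pencilChart_symm [NeZero p] (hg : g ≠ 0)
    (u : {u : ℂ | IsNonsingularForm ℂ (cyclicCoverForm p (∑ e : TernaryIndex p, monomial e.1 (f₀ e + u * g e)))}) :
    pencilCoord p f₀ g ((pencilChart p f₀ hg).symm u) = u := by
  have h := (pencilChart p f₀ hg).apply_symm_apply u
  have h' := congrArg (fun x : {u : ℂ | IsNonsingularForm ℂ (cyclicCoverForm p
    (∑ e : TernaryIndex p, monomial e.1 (f₀ e + u * g e)))} => (x : ℂ)) h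
  simpa only [pencilChart_apply_coe] using h'

/-- **The branch form of the image of the point with coordinate `u`**: `coeff_e = (f₀)_e + u g_e`.
[cite: CarlsonToledo1999, §2 (held text p0004)] -/
theorem coeff_branchForm_map_pencilMap_symm [NeZero p] (hg : g ≠ 0)
    (u : {u : ℂ | IsNonsingularForm ℂ (cyclicCoverForm p (∑ e : TernaryIndex p, monomial e.1 (f₀ e + u * g e)))})
    (e : TernaryIndex p) :
    (branchForm p (AlgPoints.map (pencilMap p f₀ g) ((pencilChart p f₀ hg).symm u))).coeff e.1 = f₀ e + u * g e := by
  rw [coeff_branchForm_map_pencilMap, pencilCoord_pencilChart_symm]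

end Chart

end LinearPencil

end Literature.AlgebraicGeometry.HodgeTheory

end
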